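import Summits.HodgeConjecture.CorCM.CMProductFourfoldsOfMarkman
import Summits.HodgeConjecture.CorCM.AndreTargetsOfRiemann
import Literature.AlgebraicGeometry.Milne1999.TateFromCodesHCOfHSimplePos
import Literature.AlgebraicGeometry.Milne1999.TateFromCodesHCOfRiemann
import Literature.AlgebraicGeometry.HodgeTheory.AbelianVarietyHodgeFullnessHolds
import HarnessLib

/-!
# The Hodge conjecture for complex abelian varieties of CM type of dimension `≤ 4`, from Markman's theorem

Cell `pub-hodgecm2` (COR-CM), count-neutral sub-row A3-CM45-products, file 4.  HONEST FRAMING: a CONDITIONAL result —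
`HC_CM` restricted to dimension `≤ 4`, conditional ONLY on the named fact
`HodgeTheory.Markman2025_weilClasses_algebraic_abelianFourfold` (Markman 2025, B2b floor R1); `HC_CM` itself is
never asserted.  The CM slice of the named fact `Markman2025_hodgeClasses_algebraic_abelian_dim_le_five` (R2) in
dimension `≤ 4`, WITHOUT the Moonen–Zarhin facts `MoonenZarhin1999_codimTwoHodgeClasses_abelianFourfold/…Fivefold` of
its printed proof.

Chain: a CM abelian variety `A` of dimension `4` is isogenous to a finite product `B` of CM-TYPED abelian varieties
(`Milne1999.hDecompPos_of_hSimplePos` at `hSimplePos_of_riemann deligneMilne1982_Thm_6_20_full_holds`: Poincaré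
reducibility + Shimura §5–§7, Riemann's theorem being the tree THEOREM `deligneMilne1982_Thm_6_20_full_holds`); such a
product is dominated by (indeed isomorphic to) a biproduct `⨁_i C_i` of realisations of CM types of CM fields `K_i`
of the SAME total dimension (`exists_biproduct_family_of_isProductOf`, gluing the families factor by factor); the
biproduct satisfies the Hodge conjecture granted Markman's fact (`CMWeights.hodgeConjectureFor_biproduct_dim_four_of_markman`);
algebraicity descends along the domination (`AndreSplit.mem_algebraicClasses_of_avDominatedBy`) and the isogeny
(`HodgeConjectureFor.of_isIsogenous`).  Dimension `≤ 3` is the tree's unconditional `hodgeConjectureFor_of_dim_le_three_holds`.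

* `exists_biproduct_family_of_isProductOf` — every `IsProductOf IsCMTyped B` is dominated by a biproduct of CM
  realisations (different fields) of total dimension `dim B`;
* **`hodgeConjectureFor_of_isOfCMType_dim_four_of_markman`** — `A` of CM type, `dim A = 4` ⟹
  `HodgeConjectureFor A.dim A.X`, granted Markman's fact;
* **`cmHodgeHypothesisAt_of_dim_le_four_of_markman`** — `Milne1999.CMHodgeHypothesisAt A` for every complex abelian
  variety of dimension `≤ 4`, granted Markman's fact (the instance of `HC_CM = RankFourFaces.CMAbelianHodge` at every
  such `A`).

## References

* [MoonenZarhin1999LowDim] B. Moonen, Yu. Zarhin, Math. Ann. 315 (1999) 711–733, Thm. 0.1.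
* [Markman2025SurveySecant] E. Markman, arXiv:2509.23403, Thm. 1.2, §1.1 and Cor. 1.3.
* [Shimura1998] G. Shimura, *Abelian Varieties with Complex Multiplication and Modular Functions*, §5.1 Props. 3–6, §7.1.
* [MumfordAV1970] D. Mumford, *Abelian Varieties*, §19 Thm. 1 and p. 169.
* [DeligneMilne1982Tannakian] P. Deligne, J. S. Milne, LNM 900, Thm. 6.20.
-/

noncomputable section

open CategoryTheory CategoryTheory.Limits NumberField

namespace Summit.HodgeConjecture.CorCM.CMWeights

open Literature.AlgebraicGeometry.Motives Literature.AlgebraicGeometry.Motives.AbelianVariety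
open Literature.AlgebraicGeometry.HodgeTheory
open Literature.AlgebraicGeometry.ComplexMultiplication (IsCMTypeRealisation)
open Literature.AlgebraicGeometry.Milne1999
open Summit.HodgeConjecture.CorCM.Domination Summit.HodgeConjecture.CorCM.AndreRiemann

/-! ### §1 Products of CM-typed abelian varieties as biproducts of realisations (different fields) -/

/-- **A finite product of CM-typed abelian varieties is dominated by a biproduct of CM realisations of the same total
dimension.**  For `B` with `IsProductOf IsCMTyped B` there are a finite family of CM fields `K_i`, CM types `Φ_i`,
realisations `(C_i, ι_i, θ_i)` on `H¹`, a domination `AVDominatedBy B (⨁_i C_i)` (in fact an isomorphism), and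
`dim ⨁_i C_i = dim B` — by induction along the product tree, gluing the families of the two factors
(`Domination.avDominatedBy_prod_of_biproduct`, `avDominatedBy_biproduct_reindex`) and adding dimensions
(`dim_prod`, `dim_biproduct_fin`). [cite: MumfordAV1970, §19 Thm. 1 and p. 169] -/
theorem exists_biproduct_family_of_isProductOf {B : AbelianVariety ℂ} (hB : IsProductOf IsCMTyped B) :
    ∃ (n : ℕ) (K : Fin n → Type) (_ : ∀ i, Field (K i)) (_ : ∀ i, NumberField (K i)) (_ : ∀ i, IsCMField (K i))
      (C : Fin n → AbelianVariety ℂ) (Φ : ∀ i, CMType (K i)) (ι : ∀ i, 𝓞 (K i) →+* End (C i))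
      (θ : ∀ i, K i →+* Module.End ℂ (complexBetti (C i).X 1)),
      (∀ i, IsCMTypeRealisation (Φ i) (C i) (ι i) (θ i)) ∧ AVDominatedBy B (⨁ C) ∧ (⨁ C).dim = B.dim := by
  classical
  induction hB with
  | @atom B hBt =>
    obtain ⟨Φ, B, ι, θ, h⟩ := hBt
    rename_i K _ _ _
    refine ⟨1, fun _ => K, fun _ => inferInstance, fun _ => inferInstance, fun _ => inferInstance, fun _ => B,
      fun _ => Φ, fun _ => ι, fun _ => θ, fun _ => h, avDominatedBy_biproduct_single B, ?_⟩
    rw [dim_biproduct_fin]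
    simp
  | @prod B₁ B₂ _ _ ih₁ ih₂ =>
    obtain ⟨n₁, K₁, iF₁, iN₁, iC₁, C₁, Φ₁, ι₁, θ₁, hC₁, hd₁, hdim₁⟩ := ih₁
    obtain ⟨n₂, K₂, iF₂, iN₂, iC₂, C₂, Φ₂, ι₂, θ₂, hC₂, hd₂, hdim₂⟩ := ih₂
    -- the glued family on `Fin n₁ ⊕ Fin n₂`
    let K : Fin n₁ ⊕ Fin n₂ → Type := fun j => match j with | Sum.inl j => K₁ j | Sum.inr j => K₂ j
    letI iF : ∀ j, Field (K j) := fun j => match j with | Sum.inl j => iF₁ j | Sum.inr j => iF₂ j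
    letI iN : ∀ j, NumberField (K j) := fun j => match j with | Sum.inl j => iN₁ j | Sum.inr j => iN₂ j
    have iC : ∀ j, IsCMField (K j) := fun j => match j with | Sum.inl j => iC₁ j | Sum.inr j => iC₂ j
    let Φ : ∀ j, CMType (K j) := fun j => match j with | Sum.inl j => Φ₁ j | Sum.inr j => Φ₂ j
    let ι : ∀ j, 𝓞 (K j) →+* End (sumFam C₁ C₂ j) := fun j => match j with | Sum.inl j => ι₁ j | Sum.inr j => ι₂ j
    let θ : ∀ j, K j →+* Module.End ℂ (complexBetti (sumFam C₁ C₂ j).X 1) :=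
      fun j => match j with | Sum.inl j => θ₁ j | Sum.inr j => θ₂ j
    have hC : ∀ j, IsCMTypeRealisation (Φ j) (sumFam C₁ C₂ j) (ι j) (θ j) :=
      fun j => match j with | Sum.inl j => hC₁ j | Sum.inr j => hC₂ j
    let e : Fin (n₁ + n₂) ≃ Fin n₁ ⊕ Fin n₂ := finSumFinEquiv.symm
    refine ⟨n₁ + n₂, fun i => K (e i), fun i => iF (e i), fun i => iN (e i), fun i => iC (e i),
      fun i => sumFam C₁ C₂ (e i), fun i => Φ (e i), fun i => ι (e i), fun i => θ (e i), fun i => hC (e i),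
      avDominatedBy_biproduct_reindex e (avDominatedBy_prod_of_biproduct hd₁ hd₂), ?_⟩
    -- dimensions: `Σ_{Fin (n₁+n₂)} = Σ_{inl} + Σ_{inr}`
    rw [dim_biproduct_fin, dim_prod, ← hdim₁, ← hdim₂, dim_biproduct_fin, dim_biproduct_fin]
    rw [show (∑ i : Fin (n₁ + n₂), (sumFam C₁ C₂ (e i)).dim) = ∑ j : Fin n₁ ⊕ Fin n₂, (sumFam C₁ C₂ j).dim from
      Fintype.sum_equiv e _ _ fun _ => rfl, Fintype.sum_sum_type]

/-! ### §2 Dimension `4`: the Hodge conjecture for CM abelian fourfolds, granted Markman's theorem -/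

/-- **The Hodge conjecture for every complex abelian variety of CM type of dimension `4`, granted Markman's theorem on
the Weil classes of abelian fourfolds.**  `A` is isogenous to a product of CM-typed abelian varieties (Poincaré
reducibility and Shimura's structure theory at simple CM abelian varieties, `Milne1999.hDecompPos_of_hSimplePos`, with
Riemann's theorem `deligneMilne1982_Thm_6_20_full_holds`), which is dominated by a biproduct of CM realisations of
total dimension `4` (`exists_biproduct_family_of_isProductOf`); there the Hodge conjecture holds granted Markman's fact
(`hodgeConjectureFor_biproduct_dim_four_of_markman`: Pohlmann's theorem + «divisor pairs or Weil section» + Lefschetz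
`(1,1)` + hard Lefschetz), and algebraicity descends along the domination and the isogeny.  This is the CM slice,
in dimension `4`, of Moonen–Zarhin 1999 Thm. 0.1 + Markman 2025 (the fact
`Markman2025_hodgeClasses_algebraic_abelian_dim_le_five`), with the Moonen–Zarhin input re-proved for CM varieties.
[cite: MoonenZarhin1999LowDim, Thm. 0.1] [cite: Markman2025SurveySecant, §1.1 and Cor. 1.3]
[cite: Shimura1998, §5.1 Props. 3–6 and §7.1] [cite: MumfordAV1970, §19 Thm. 1] -/
theorem hodgeConjectureFor_of_isOfCMType_dim_four_of_markman
    (hW4 : Markman2025_weilClasses_algebraic_abelianFourfold) (A : AbelianVariety ℂ) (hCM : IsOfCMType A)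
    (h4 : A.dim = 4) : HodgeConjectureFor A.dim A.X := by
  obtain ⟨B, hB, hAB⟩ :=
    hDecompPos_of_hSimplePos (hSimplePos_of_riemann deligneMilne1982_Thm_6_20_full_holds) A (by omega) hCM
  obtain ⟨n, K, iF, iN, iC, C, Φ, ι, θ, hC, hdom, hdim⟩ := exists_biproduct_family_of_isProductOf hB
  have hBdim : B.dim = 4 := by
    obtain ⟨g, hg⟩ := hAB
    rw [← dim_eq_of_isIsogeny hg, h4]
  have hCdim : (⨁ C).dim = 4 := hdim.trans hBdim
  have hP : HodgeConjectureFor (⨁ C).dim (⨁ C).X := hodgeConjectureFor_biproduct_dim_four_of_markman' hW4 hC hCdim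
  have hBhc : HodgeConjectureFor B.dim B.X :=
    ⟨nonempty_hodgeModel_holds (AbelianVariety.isSmoothProjective_holds (A := B)), fun p c hc hpp =>
      AndreSplit.mem_algebraicClasses_of_avDominatedBy hdom (fun c' hc' hh' => hP.2 p c' hc' hh') c hc hpp⟩
  exact HodgeConjectureFor.of_isIsogenous hAB hBhc

/-- **`HC_CM` in dimension `≤ 4`, granted Markman's theorem**: Milne's hypothesis `CMHodgeHypothesisAt A` (the
instance at `A` of the cell's E-term `HC_CM = RankFourFaces.CMAbelianHodge`) holds for every complex abelian variety
`A` of dimension `≤ 4`, conditional only on `Markman2025_weilClasses_algebraic_abelianFourfold`: dimension `≤ 3` is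
the tree's unconditional `hodgeConjectureFor_of_dim_le_three_holds`, dimension `4` is
`hodgeConjectureFor_of_isOfCMType_dim_four_of_markman`. [cite: MoonenZarhin1999LowDim, Thm. 0.1]
[cite: Markman2025SurveySecant, §1.1 and Cor. 1.3] -/
theorem cmHodgeHypothesisAt_of_dim_le_four_of_markman (hW4 : Markman2025_weilClasses_algebraic_abelianFourfold)
    (A : AbelianVariety ℂ) (hA : A.dim ≤ 4) : CMHodgeHypothesisAt A := by
  rcases Nat.lt_or_ge A.dim 4 with hlt | hge
  · exact fun hX _ => hodgeConjectureFor_of_dim_le_three_holds (by omega) hX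
  · exact fun _ hCM => hodgeConjectureFor_of_isOfCMType_dim_four_of_markman hW4 A hCM (le_antisymm hA hge)

end Summit.HodgeConjecture.CorCM.CMWeights

end
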